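import Literature.Analysis.FluidPDE.LocalPressureOscillationSlab
import Literature.Analysis.FluidPDE.LocalPressureLiouville
import Literature.Analysis.FluidPDE.LocalLerayPressureBound
import Literature.Analysis.FluidPDE.LocalLerayPressureBoundTools
import Literature.Analysis.FluidPDE.LerayPressureDecayReduction
import Literature.Analysis.FluidPDE.LocalPressureOscillation
import HarnessLib

/-!
# Discharge of `kangMiuraTsai_local_pressure_bound` (the local `L^{3/2}` bound for the gauged
pressure of a local Leray solution on a slab; Kang–Miura–Tsai 2021, Lemma 3.4 and §8)

Analysis/FluidPDE proof file (theorems only) for the named fact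
`Literature.Analysis.FluidPDE.kangMiuraTsai_local_pressure_bound` (`LocalLerayPressureBound.lean`):
for `T, R > 0`, `A ≥ 0` one constant `K = K(T, R, A)` such that every local Leray solution
`(v, π)` on `(0, T) × ℝ³` with uniformly local energy `≤ A` on unit balls admits, at every centre
`x₀`, a gauge `c ∈ L^{3/2}(0, T)` with `∫₀ᵀ∫_{B_R(x₀)} |π - c(t)|^{3/2} ≤ K`
(Kang–Miura–Tsai, IMRN 2021 = arXiv:1812.10509, the bound
"`‖p̄_{x₀,R}‖_{L^s(0,T;L^q(B_{3R/2}(x₀)))} ≤ c(T,R,s,q) A`" printed in the proof of Lemma 3.4, §8,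
case `s = q = 3/2`). Main result:

* `kangMiuraTsai_local_pressure_bound_holds : kangMiuraTsai_local_pressure_bound` — PROVED.

The gauge is the ball mean `c(t) = ⨍_{B_R(x₀)} π(t)` (in `L^{3/2}(0,T)` by Hölder and Fubini, as in
`IsLocalLeraySolution.memLp_setAverage_pressure`); the slice estimate is the tree's route

  Liouville for the mollified pressure-gradient functional (`LocalPressureLiouville.lean`,
  `IsLocalLeraySolutionOn.ae_slice_pgIdentity`) → the slice oscillation estimate
  (`LocalPressureOscillationSlab.lean`, `slice_pressure_oscillation_le`) → mean gauge ×4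
  (`setLIntegral_rpow_sub_average_le_of_const`) → integration in time with the explicit cubic
  bound (`exists_lintegral_cube_box_le_explicit`, `LocalLerayPressureBoundTools.lean`) and the
  uniformly local far-field tail (`lintegral_compl_ball_mul_powKer_le`),

which realises the printed proof of Kang–Miura–Tsai §8 (Calderón–Zygmund for `p_loc`,
`|p_far| ≤ ∫_{2R<|y-x₀|} cR|x₀-y|⁻⁴|v|²`, Liouville) without the mild-solution reconstruction, in
the form of the characterisation of the pressure gradient by Fernández-Dalgo–Lemarié-Rieusset
(DCDS-S 14 (2021), Thm. 1) recorded in the module docstring of `LocalLerayPressureBound.lean`.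
The datum hypotheses of the fact (`v₀ ∈ L²_uloc`, weakly divergence free) are not used.

## References

* K. Kang, H. Miura, T.-P. Tsai, IMRN 2021 = arXiv:1812.10509, Lemma 3.4, §8.
  [`KangMiuraTsai2020`]
* H. Jia, V. Šverák, Invent. Math. 196 (2014) = arXiv:1204.0529, §3. [`JiaSverak2014`]
* P. G. Fernández-Dalgo, P. G. Lemarié-Rieusset, DCDS-S 14 (2021) = arXiv:2001.10436, Thm. 1.
  [`FernandezdalgoLemarierieusset2021`]
-/

noncomputable section

open MeasureTheory Set Filter Topology Function Metric
open scoped ENNReal NNReal RealInnerProductSpace Laplacian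

namespace Literature.Analysis.FluidPDE

-- nested operator types `ℝ³ →L[ℝ] ℝ³ →L[ℝ] ℝ³ →L[ℝ] ℝ`
set_option maxSynthPendingDepth 3

/-- **The mean gauge is in `L^{3/2}(0, T)`** for a local Leray solution on the slab (Fubini for
the measurability, Hölder on the ball, `π ∈ L^{3/2}((0,T) × B̄)` by clause (1) of the class).
[folklore] -/
theorem IsLocalLeraySolutionOn.memLp_setAverage_pressure {T ν : ℝ}
    {v₀ : EuclideanSpace ℝ (Fin 3) → EuclideanSpace ℝ (Fin 3)}
    {v : ℝ → EuclideanSpace ℝ (Fin 3) → EuclideanSpace ℝ (Fin 3)}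
    {π : ℝ → EuclideanSpace ℝ (Fin 3) → ℝ} (hv : IsLocalLeraySolutionOn T ν v₀ v π)
    (x₁ : EuclideanSpace ℝ (Fin 3)) {r : ℝ} (hr : 0 < r) :
    MemLp (fun t => ⨍ y in ball x₁ r, π t y) (3 / 2 : ℝ≥0∞) (volume.restrict (Ioo (0 : ℝ) T)) := by
  set B : Set (EuclideanSpace ℝ (Fin 3)) := ball x₁ r with hB
  set μt : Measure ℝ := volume.restrict (Ioo (0 : ℝ) T) with hμt
  set μB : Measure (EuclideanSpace ℝ (Fin 3)) := volume.restrict B with hμB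
  have hprod : μt.prod μB = volume.restrict (Ioo (0 : ℝ) T ×ˢ B) := by
    rw [hμt, hμB, Measure.prod_restrict, ← Measure.volume_eq_prod]
  have hπm : AEStronglyMeasurable (uncurry π) (μt.prod μB) := by
    rw [hprod]
    exact hv.aestronglyMeasurable_pressure.mono_measure
      (Measure.restrict_mono (prod_mono Subset.rfl (subset_univ _)) le_rfl)
  have hV0 : volume B ≠ 0 := (measure_ball_pos volume x₁ hr).ne'
  have hVtop : volume B ≠ ∞ := measure_ball_lt_top.ne
  have hne0 : (3 / 2 : ℝ≥0∞) ≠ 0 := (ENNReal.div_pos_iff.2 ⟨by norm_num, by norm_num⟩).ne'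
  have hnetop : (3 / 2 : ℝ≥0∞) ≠ ∞ := ENNReal.div_ne_top (by norm_num) (by norm_num)
  have h1le : (1 : ℝ≥0∞) ≤ 3 / 2 := by
    rw [ENNReal.le_div_iff_mul_le (Or.inl (by norm_num)) (Or.inl (by norm_num))]
    norm_num
  have hmeas : AEStronglyMeasurable (fun t => ⨍ y in B, π t y) μt := by
    have h1 : AEStronglyMeasurable (fun t => ∫ y in B, π t y) μt := hπm.integral_prod_right'
    have h2 : (fun t => ⨍ y in B, π t y) = fun t =>
        ((volume : Measure (EuclideanSpace ℝ (Fin 3))).real B)⁻¹ • ∫ y in B, π t y := by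
      funext t
      rw [setAverage_eq]
    rw [h2]
    exact h1.const_smul (((volume : Measure (EuclideanSpace ℝ (Fin 3))).real B)⁻¹)
  refine ⟨hmeas, ?_⟩
  have hslice : ∀ᵐ t ∂μt, AEStronglyMeasurable (π t) μB := hπm.prodMk_left
  set κ : ℝ≥0∞ := (‖((volume : Measure (EuclideanSpace ℝ (Fin 3))).real B)⁻¹‖ₑ *
    (volume B) ^ (1 / 3 : ℝ)) ^ (3 / 2 : ℝ) with hκ
  have hκtop : κ ≠ ∞ := ENNReal.rpow_ne_top_of_nonneg (by norm_num)
    (ENNReal.mul_ne_top enorm_ne_top (ENNReal.rpow_ne_top_of_nonneg (by norm_num) hVtop))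
  have hpt : ∀ᵐ t ∂μt, ‖⨍ y in B, π t y‖ₑ ^ (3 / 2 : ℝ) ≤
      κ * ∫⁻ y in B, ‖π t y‖ₑ ^ (3 / 2 : ℝ) := by
    filter_upwards [hslice] with t ht
    have h1 : ‖⨍ y in B, π t y‖ₑ ≤ ‖((volume : Measure (EuclideanSpace ℝ (Fin 3))).real B)⁻¹‖ₑ *
        (volume B) ^ (1 / 3 : ℝ) * eLpNorm (π t) (3 / 2) μB := by
      rw [setAverage_eq, enorm_smul, mul_assoc]
      gcongr
      calc ‖∫ y in B, π t y‖ₑ ≤ ∫⁻ y in B, ‖π t y‖ₑ := enorm_integral_le_lintegral_enorm _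
        _ = eLpNorm (π t) 1 μB := by rw [eLpNorm_one_eq_lintegral_enorm]
        _ ≤ eLpNorm (π t) (3 / 2) μB *
            μB univ ^ (1 / (1 : ℝ≥0∞).toReal - 1 / (3 / 2 : ℝ≥0∞).toReal) :=
          eLpNorm_le_eLpNorm_mul_rpow_measure_univ h1le ht
        _ = (volume B) ^ (1 / 3 : ℝ) * eLpNorm (π t) (3 / 2) μB := by
          rw [hμB, Measure.restrict_apply_univ, ENNReal.toReal_one, ennreal_toReal_three_halves,
            mul_comm]
          norm_num
    calc ‖⨍ y in B, π t y‖ₑ ^ (3 / 2 : ℝ)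
        ≤ (‖((volume : Measure (EuclideanSpace ℝ (Fin 3))).real B)⁻¹‖ₑ * (volume B) ^ (1 / 3 : ℝ) *
            eLpNorm (π t) (3 / 2) μB) ^ (3 / 2 : ℝ) := ENNReal.rpow_le_rpow h1 (by norm_num)
      _ = κ * eLpNorm (π t) (3 / 2) μB ^ (3 / 2 : ℝ) := by
          rw [hκ, ENNReal.mul_rpow_of_nonneg _ _ (by norm_num)]
      _ = κ * ∫⁻ y in B, ‖π t y‖ₑ ^ (3 / 2 : ℝ) := by
          rw [eLpNorm_rpow_three_halves_eq]
  rw [eLpNorm_eq_lintegral_rpow_enorm_toReal hne0 hnetop, ennreal_toReal_three_halves]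
  refine ENNReal.rpow_lt_top_of_nonneg (by norm_num) (ne_of_lt ?_)
  calc ∫⁻ t, ‖⨍ y in B, π t y‖ₑ ^ (3 / 2 : ℝ) ∂μt
      ≤ ∫⁻ t, κ * (∫⁻ y in B, ‖π t y‖ₑ ^ (3 / 2 : ℝ)) ∂μt := lintegral_mono_ae hpt
    _ = κ * ∫⁻ z in Ioo 0 T ×ˢ B, ‖π z.1 z.2‖ₑ ^ (3 / 2 : ℝ) := by
        rw [lintegral_const_mul' _ _ hκtop, hμt, lintegral_lintegral_enorm_rpow_box hπm]
    _ < ∞ := by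
        refine ENNReal.mul_lt_top hκtop.lt_top ?_
        exact (lintegral_mono_set (Set.prod_mono Subset.rfl ball_subset_closedBall)).trans_lt
          (hv.pressure _ (isCompact_closedBall x₁ r))

/-- **Discharge of `kangMiuraTsai_local_pressure_bound`.** See the module docstring.
[cite: KangMiuraTsai2020, Lemma 3.4 and its proof, §8 (arXiv:1812.10509 pp. 8, 17–18)] [cite: JiaSverak2014, §3 remark after Def. 1] -/
theorem kangMiuraTsai_local_pressure_bound_holds : kangMiuraTsai_local_pressure_bound := by
  intro T R A hT hR
  -- ## constants
  obtain ⟨CN, CK, hCK0, hslice⟩ := slice_pressure_oscillation_le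
  obtain ⟨Kc, hKc⟩ := exists_lintegral_cube_box_le_explicit (2 * (R + 1))
  set V1 : ℝ≥0∞ := volume (ball (0 : EuclideanSpace ℝ (Fin 3)) 1) with hV1
  set Vρ : ℝ≥0∞ := volume (ball (0 : EuclideanSpace ℝ (Fin 3)) (2 * (R + 1) + 1)) with hVρ
  set Aρ : ℝ≥0∞ := V1⁻¹ * ((A : ℝ≥0∞) * Vρ) with hAρ
  set IT : ℝ≥0∞ := volume (Ioo (0 : ℝ) T) with hIT
  set CUBE : ℝ≥0∞ := Kc * Aρ ^ (1 / 2 : ℝ) *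
    ((Aρ * IT) ^ (1 / 4 : ℝ) * (Aρ * IT + Aρ) ^ (3 / 4 : ℝ)) with hCUBE
  set TailB : ℝ≥0∞ := V1⁻¹ * ((A : ℝ≥0∞) *
    (16 * ∫⁻ z in (ball (0 : EuclideanSpace ℝ (Fin 3)) (2 * (R + 1) - 1))ᶜ, RieszKernel.powKer 4 z))
    with hTailB
  set VR : ℝ≥0∞ := volume (ball (0 : EuclideanSpace ℝ (Fin 3)) R) with hVR
  set s2 : ℝ≥0∞ := (2 : ℝ≥0∞) ^ (1 / 2 : ℝ) with hs2
  set Ktot : ℝ≥0∞ := 4 * (s2 * ((CN : ℝ≥0∞) ^ (3 / 2 : ℝ) * CUBE +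
    VR * (ENNReal.ofReal (CK * (R + 1)) * TailB) ^ (3 / 2 : ℝ) * IT)) with hKtot
  -- ## finiteness of the constants
  have hV10 : V1 ≠ 0 := (measure_ball_pos volume _ one_pos).ne'
  have hV1inv : V1⁻¹ ≠ ⊤ := ENNReal.inv_ne_top.2 hV10
  have hVρtop : Vρ ≠ ⊤ := measure_ball_lt_top.ne
  have hAρtop : Aρ ≠ ⊤ :=
    ENNReal.mul_ne_top hV1inv (ENNReal.mul_ne_top ENNReal.coe_ne_top hVρtop)
  have hITtop : IT ≠ ⊤ := by rw [hIT, Real.volume_Ioo]; exact ENNReal.ofReal_ne_top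
  have hCUBEtop : CUBE ≠ ⊤ := by
    refine ENNReal.mul_ne_top (ENNReal.mul_ne_top ENNReal.coe_ne_top
      (ENNReal.rpow_ne_top_of_nonneg (by norm_num) hAρtop)) (ENNReal.mul_ne_top ?_ ?_)
    · exact ENNReal.rpow_ne_top_of_nonneg (by norm_num) (ENNReal.mul_ne_top hAρtop hITtop)
    · exact ENNReal.rpow_ne_top_of_nonneg (by norm_num)
        (ENNReal.add_ne_top.2 ⟨ENNReal.mul_ne_top hAρtop hITtop, hAρtop⟩)
  have hTailBtop : TailB ≠ ⊤ := by
    refine ENNReal.mul_ne_top hV1inv (ENNReal.mul_ne_top ENNReal.coe_ne_top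
      (ENNReal.mul_ne_top (by norm_num) ?_))
    exact (RieszKernel.lintegral_compl_ball_powKer_lt_top (by norm_num) (by linarith)).ne
  have hs2top : s2 ≠ ⊤ := ENNReal.rpow_ne_top_of_nonneg (by norm_num) ENNReal.ofNat_ne_top
  have hVRtop : VR ≠ ⊤ := measure_ball_lt_top.ne
  have hKtot_top : Ktot ≠ ⊤ := by
    refine ENNReal.mul_ne_top (by norm_num) (ENNReal.mul_ne_top hs2top (ENNReal.add_ne_top.2 ⟨?_, ?_⟩))
    · exact ENNReal.mul_ne_top (ENNReal.rpow_ne_top_of_nonneg (by norm_num) ENNReal.coe_ne_top) hCUBEtop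
    · exact ENNReal.mul_ne_top (ENNReal.mul_ne_top hVRtop (ENNReal.rpow_ne_top_of_nonneg (by norm_num)
        (ENNReal.mul_ne_top ENNReal.ofReal_ne_top hTailBtop))) hITtop
  -- ## the bound `K = Ktot`
  refine ⟨Ktot.toNNReal, fun v₀ v π hv _h₀ _hdiv hE hGex x₀ => ?_⟩
  rw [ENNReal.coe_toNNReal hKtot_top]
  obtain ⟨G, hG, hGb⟩ := hGex
  -- the gauge: the ball mean
  refine ⟨fun t => ⨍ y in ball x₀ R, π t y, hv.memLp_setAverage_pressure x₀ hR, ?_⟩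
  -- ## names
  set B : Set (EuclideanSpace ℝ (Fin 3)) := ball x₀ R with hB
  set μt : Measure ℝ := volume.restrict (Ioo (0 : ℝ) T) with hμt
  set μB : Measure (EuclideanSpace ℝ (Fin 3)) := volume.restrict B with hμB
  set g₃ : ℝ → ℝ≥0∞ := fun t => ∫⁻ x in ball x₀ (2 * (R + 1)), ‖v t x‖ₑ ^ (3 : ℕ) with hg₃
  set c : ℝ → ℝ := fun t => ⨍ y in B, π t y with hc
  -- ## measurability
  have hvm := hv.aestronglyMeasurable_prod
  have hπm := hv.aestronglyMeasurable_pressure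
  have hbox : ∀ S : Set (EuclideanSpace ℝ (Fin 3)),
      μt.prod (volume.restrict S) = volume.restrict (Ioo (0 : ℝ) T ×ˢ S) := fun S => by
    rw [hμt, Measure.prod_restrict, ← Measure.volume_eq_prod]
  have hvmS : ∀ S : Set (EuclideanSpace ℝ (Fin 3)),
      AEStronglyMeasurable (uncurry v) (μt.prod (volume.restrict S)) := fun S =>
    hvm.mono_measure (Measure.prod_mono le_rfl Measure.restrict_le_self)
  have hF : ∀ (S : Set (EuclideanSpace ℝ (Fin 3))) (n : ℕ),
      AEMeasurable (fun z : ℝ × EuclideanSpace ℝ (Fin 3) => ‖v z.1 z.2‖ₑ ^ n)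
        (μt.prod (volume.restrict S)) := fun S n => (hvmS S).enorm.pow_const n
  have hGm : AEStronglyMeasurable (uncurry G) (volume.restrict (Ioo (0 : ℝ) T ×ˢ univ)) := by
    rw [← coe_slab_Ioo]
    exact hG.locallyIntegrableOn_grad.aestronglyMeasurable
  have hFG : ∀ S : Set (EuclideanSpace ℝ (Fin 3)), AEMeasurable
      (fun z : ℝ × EuclideanSpace ℝ (Fin 3) => ENNReal.ofReal (frobeniusNormSq (G z.1 z.2)))
      (μt.prod (volume.restrict S)) := fun S => by
    have h1 : AEStronglyMeasurable (uncurry G) (μt.prod (volume.restrict S)) := by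
      rw [hbox]
      exact hGm.mono_measure (Measure.restrict_mono (prod_mono Subset.rfl (subset_univ _)) le_rfl)
    exact (continuous_frobeniusNormSq'.comp_aestronglyMeasurable h1).aemeasurable.ennreal_ofReal
  have hslice_meas := hv.ae_aestronglyMeasurable_slice'
  -- ## the uniformly local energy on balls of radius `2(R+1)`, a.e. in time
  have hAρ_t : ∀ᵐ t ∂μt, ∫⁻ x in ball x₀ (2 * (R + 1)), ‖v t x‖ₑ ^ 2 ≤ Aρ := by
    filter_upwards [hslice_meas, hE] with t hmt hEt
    exact setLIntegral_ball_le_of_forall_unitBall (hmt.enorm.pow_const 2) hEt x₀ (2 * (R + 1))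
  -- ## the uniformly local gradient bound on the box of radius `2(R+1)`
  have hGρ : ∫⁻ z in Ioo 0 T ×ˢ ball x₀ (2 * (R + 1)),
      ENNReal.ofReal (frobeniusNormSq (G z.1 z.2)) ≤ Aρ := by
    set gG : EuclideanSpace ℝ (Fin 3) → ℝ≥0∞ := fun y =>
      ∫⁻ t in Ioo 0 T, ENNReal.ofReal (frobeniusNormSq (G t y)) with hgG
    have hton : ∀ S : Set (EuclideanSpace ℝ (Fin 3)), ∫⁻ z in Ioo 0 T ×ˢ S,
        ENNReal.ofReal (frobeniusNormSq (G z.1 z.2)) = ∫⁻ y in S, gG y := fun S => by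
      rw [← hbox S, lintegral_prod_symm _ (hFG S)]
    have hgGm : AEMeasurable gG volume := by
      have h1 : AEMeasurable
          (fun z : ℝ × EuclideanSpace ℝ (Fin 3) => ENNReal.ofReal (frobeniusNormSq (G z.1 z.2)))
          (μt.prod (volume : Measure (EuclideanSpace ℝ (Fin 3)))) := by
        have := hFG univ
        rwa [Measure.restrict_univ] at this
      exact h1.prod_swap.lintegral_prod_right'
    have hunit : ∀ z : EuclideanSpace ℝ (Fin 3), ∫⁻ y in ball z 1, gG y ≤ (A : ℝ≥0∞) := fun z => by
      rw [← hton]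
      exact hGb z
    rw [hton]
    exact setLIntegral_ball_le_of_forall_unitBall hgGm hunit x₀ (2 * (R + 1))
  -- ## the cubic functional on the box of radius `2(R+1)`
  have hG₃le : ∫⁻ z in Ioo 0 T ×ˢ ball x₀ (2 * (R + 1)), ‖v z.1 z.2‖ₑ ^ (3 : ℕ) ≤ CUBE :=
    hKc T v G x₀ Aρ Aρ hAρtop hG hAρ_t hGρ
  have hg₃m : AEMeasurable g₃ μt := (hF (ball x₀ (2 * (R + 1))) 3).lintegral_prod_right'
  have hT3 : ∫⁻ z in Ioo 0 T ×ˢ ball x₀ (2 * (R + 1)), ‖v z.1 z.2‖ₑ ^ (3 : ℕ) = ∫⁻ t, g₃ t ∂μt := by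
    rw [← hbox, lintegral_prod _ (hF _ 3)]
  -- ## the a.e. slice identities (Liouville) and the slice oscillation estimate
  obtain ⟨A', hgood⟩ := hv.ae_slice_pgIdentity
  have hIB : ∀ᵐ t ∂μt, IntegrableOn (π t) B volume := by
    filter_upwards [hv.ae_locallyIntegrable_pressure_slice] with t ht
    exact (ht.integrableOn_isCompact (isCompact_closedBall x₀ R)).mono_set ball_subset_closedBall
  have hinner : ∀ᵐ t ∂μt, ∫⁻ x, ‖π t x - c t‖ₑ ^ (3 / 2 : ℝ) ∂μB ≤
      4 * (s2 * ((CN : ℝ≥0∞) ^ (3 / 2 : ℝ) * g₃ t +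
        VR * (ENNReal.ofReal (CK * (R + 1)) * TailB) ^ (3 / 2 : ℝ))) := by
    filter_upwards [hgood, hE, hIB, hslice_meas] with t ht hEt hIBt hmt
    obtain ⟨-, -, hπt, -, -, hid⟩ := ht
    obtain ⟨κ, hκ⟩ := hslice (v t) (A : ℝ≥0∞) (π t) hmt ENNReal.coe_ne_top hEt hπt hid x₀ R hR
    have hB0 : volume B ≠ 0 := (measure_ball_pos volume x₀ hR).ne'
    have hBt : volume B ≠ ⊤ := measure_ball_lt_top.ne
    have hmean := setLIntegral_rpow_sub_average_le_of_const hB0 hBt hIBt κ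
    -- the far-field tail at time `t` is bounded uniformly
    have hfar : ∫⁻ y in (ball x₀ (2 * (R + 1)))ᶜ,
        ‖v t y‖ₑ ^ (2 : ℕ) * RieszKernel.powKer 4 (y - x₀) ≤ TailB :=
      lintegral_compl_ball_mul_powKer_le (hmt.enorm.pow_const _) hEt x₀ (by linarith)
    calc ∫⁻ x, ‖π t x - c t‖ₑ ^ (3 / 2 : ℝ) ∂μB
        ≤ 4 * ∫⁻ x in B, ‖π t x - κ‖ₑ ^ (3 / 2 : ℝ) := hmean
      _ ≤ 4 * (s2 * ((CN : ℝ≥0∞) ^ (3 / 2 : ℝ) * g₃ t +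
          volume B * (ENNReal.ofReal (CK * (R + 1)) *
            ∫⁻ y in (ball x₀ (2 * (R + 1)))ᶜ,
              ‖v t y‖ₑ ^ (2 : ℕ) * RieszKernel.powKer 4 (y - x₀)) ^ (3 / 2 : ℝ))) :=
          mul_le_mul' le_rfl hκ
      _ ≤ 4 * (s2 * ((CN : ℝ≥0∞) ^ (3 / 2 : ℝ) * g₃ t +
          VR * (ENNReal.ofReal (CK * (R + 1)) * TailB) ^ (3 / 2 : ℝ))) := by
          rw [hB, Measure.addHaar_ball_center volume x₀ R]
          gcongr
  -- ## integrate in time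
  have hGm' : AEStronglyMeasurable
      (fun z : ℝ × EuclideanSpace ℝ (Fin 3) => π z.1 z.2 - c z.1) (μt.prod μB) := by
    refine AEStronglyMeasurable.sub ?_ ?_
    · rw [hμB, hbox]
      exact hπm.mono_measure (Measure.restrict_mono (prod_mono Subset.rfl (subset_univ _)) le_rfl)
    · exact (hv.memLp_setAverage_pressure x₀ hR).aestronglyMeasurable.comp_fst
  have hTI : ∫⁻ z in Ioo 0 T ×ˢ B, ‖π z.1 z.2 - c z.1‖ₑ ^ (3 / 2 : ℝ) =
      ∫⁻ t, ∫⁻ x, ‖π t x - c t‖ₑ ^ (3 / 2 : ℝ) ∂μB ∂μt := by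
    rw [← hbox B, ← hμB, lintegral_prod _ (hGm'.enorm.pow_const _)]
  have hμtuniv : μt univ = IT := by rw [hμt, Measure.restrict_apply_univ]
  have hm1 : AEMeasurable (fun t => 4 * (s2 * ((CN : ℝ≥0∞) ^ (3 / 2 : ℝ) * g₃ t))) μt :=
    ((hg₃m.const_mul _).const_mul _).const_mul _
  calc ∫⁻ z in Ioo 0 T ×ˢ B, ‖π z.1 z.2 - c z.1‖ₑ ^ (3 / 2 : ℝ)
      = ∫⁻ t, ∫⁻ x, ‖π t x - c t‖ₑ ^ (3 / 2 : ℝ) ∂μB ∂μt := hTI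
    _ ≤ ∫⁻ t, (4 * (s2 * ((CN : ℝ≥0∞) ^ (3 / 2 : ℝ) * g₃ t +
          VR * (ENNReal.ofReal (CK * (R + 1)) * TailB) ^ (3 / 2 : ℝ)))) ∂μt := lintegral_mono_ae hinner
    _ = ∫⁻ t, (4 * (s2 * ((CN : ℝ≥0∞) ^ (3 / 2 : ℝ) * g₃ t)) +
          4 * (s2 * (VR * (ENNReal.ofReal (CK * (R + 1)) * TailB) ^ (3 / 2 : ℝ)))) ∂μt := by
        refine lintegral_congr fun t => ?_
        ring
    _ = 4 * (s2 * ((CN : ℝ≥0∞) ^ (3 / 2 : ℝ) * ∫⁻ t, g₃ t ∂μt)) +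
          4 * (s2 * (VR * (ENNReal.ofReal (CK * (R + 1)) * TailB) ^ (3 / 2 : ℝ))) * μt univ := by
        rw [lintegral_add_left' hm1, lintegral_const, lintegral_const_mul'' _ ((hg₃m.const_mul _).const_mul _),
          lintegral_const_mul'' _ (hg₃m.const_mul _), lintegral_const_mul'' _ hg₃m]
    _ ≤ 4 * (s2 * ((CN : ℝ≥0∞) ^ (3 / 2 : ℝ) * CUBE)) +
          4 * (s2 * (VR * (ENNReal.ofReal (CK * (R + 1)) * TailB) ^ (3 / 2 : ℝ))) * IT := by
        rw [← hT3, hμtuniv]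
        gcongr
    _ = Ktot := by rw [hKtot]; ring

end Literature.Analysis.FluidPDE
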